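import Summits.QuantumFields.YangMills.Theorems.BalabanUVNodesN08AlphaEq324RowClassSocketAllSteps
import Literature.MathematicalPhysics.QuantumFieldTheory.Balaban1983to89.B1Eq324BenfattoKernelSect5ClassBasicLemmaExplicit

/-!
# Route «BalabanUVNodes», Track-A DAG node N08 = [Balaban1985UV3] Thm 1 p. 257 ∕ Thm 2 p. 272 — THE CLASS ROAD ∘ THE (α)-SOCKET AT EVERY RUN STEP (b-ROUTE): the (3.24) row
# `h324` of the edited clauses for EVERY a.e. presentation of the step block by a class member, at EVERY step `k ≤ K`, under the EXPLICIT threshold window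
# `B*_noPad(γ_A, J_c, θ, M, M₂, d, D) < b₀` (part 6 of the class socket)

Cell `pub-ymgap`, seat `pub-ymgap-dag-n08-w4` gen 5 (INTENT-8; junction word INBOX l.39030).  `bears_on: R4∕N08`; filed `--supports stmt-QuantumFields-27364` (K1⁹, helper).
THEOREMS ONLY (def-free, sorry-free, standard axioms); seat n08-c's `…ClassBasicLemmaExplicit.classBasicLemma_kernel_noPad` (the NO-PAD class Basic Lemma of [BenfattoEtAl1978]
p. 152 for the Gaussian field of every member, knit form `∀ b > B*` with `B*` EXPLICIT — over n08-d's collar `…ClassCollar`, n08-b's packs and n08-c's signed knit) and part 3's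
`…RowClassSocketAllSteps.exists_h324Row_freeLetter_of_classSandwich_allSteps_of_forall_gt_ae` consumed BY NAME.

WHY.  Part 5 (`…RowClassSocketEnd`) composes the class road's POST-CONSUMER output with the socket — valid at the steps with `g_k ≤ η₀` (the η-route; its all-coupling edition waits
for n08-d's `…KernelEq324` v1.1 over `…Eq324UnitRange`).  The b-route needs no `η₀`: the knit form `∀ b > B*` of the no-pad class lemma feeds part 3's all-steps socket directly,
the ONLY proviso being the THRESHOLD WINDOW — the class road's explicit `B*` below the record's `b₀` (print: (7) p. 257 «b₀ is a sufficiently large absolute constant»), displayed as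
`hbw` with n08-c's formula written out VERBATIM (a decidable inequality between N06-type class scalars and the record).
* ★★★★ `exists_h324Row_freeLetter_of_kernelNoPad_allSteps_ae` — `∃ C ≥ 0` from `(d, γ_A, J_c, θ, M, M₂, D, ϰ, b₀, p₀, σ, c₀, n̄, κ₀)` alone; ∀ `S 𝔖`, ∀ `k ≤ S.K`, ∀ `v`
  (`C·v ≤ Ca + Cc`): member (`hK`, `Λ ≠ ∅`, symmetric, `γ_A`-coercive, rows `J_c, M, M₂`) + a.e. presentation + instance (`∅ ≠ I ⊇ J`, `J ⊆ Λ`, `coefSup ≤ c₀·g_k^σ`,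
  `|I| ≤ v·|T₁^{(k)}|`) ⟹ `StepAlphaEq324CoreLTAtAC.h324` ∕ `StepAlphaEq324CoreLTAt.h324` at the free letter; `…_rec_one` (record's `b₀, p₀`, σ = 1).
HONEST SCOPE.  A composition by name (two `obtain`s); the member, the presentation, the instance data and the window are HYPOTHESES (IDENT = NODE 00 objects, NOT commissioned, NOT
claimed; the class scalars at [B10]'s data = N06 [B9] in-edges; `γ_A ≥ 2` is the class road's normalisation — n08-b's `…ClassRescale` serves any `γ_A > 0` on the η-route);
nothing of [Balaban1985UV3] ∕ [BenfattoEtAl1978] ∕ [Balaban1985BackgroundPropagators] asserted or discharged; `PrintedUV3V` NOT proved; N08 NOT discharged; count-neutral; one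
finite 𝕋⁴ programme at fixed ε — R4 closes the conditional finite-𝕋⁴ rung `BalabanLadder.UV` only; nothing continuum ∕ ℝ⁴ ∕ OS ∕ mass gap ∕ Clay.
-/

noncomputable section

namespace Summit.QuantumFields.YangMills.Theorems.BalabanUVNodesN08AlphaEq324RowClassSocketEndAllSteps

open MeasureTheory
open scoped BigOperators Nat
open Literature.MathematicalPhysics.QuantumFieldTheory (gaussianFieldOfKernel)
open Literature.MathematicalPhysics.QuantumFieldTheory.Balaban1983to89
open Literature.MathematicalPhysics.QuantumFieldTheory.Balaban1983to89.B1Sect3Statements (Eq324)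
open Literature.MathematicalPhysics.QuantumFieldTheory.Balaban1983to89.B1Eq324BenfattoLemma (Coef hamiltonian coefSup smallFieldSet cutoffBoltzmann cumulantSum errTerm)
open Literature.MathematicalPhysics.QuantumFieldTheory.Balaban1983to89.B1Eq324BenfattoKernelSect5ClassBasicLemmaExplicit (classBasicLemma_kernel_noPad)
open Literature.MathematicalPhysics.QuantumFieldTheory.Balaban1985CMP102.Setting
open Summit.QuantumFields.Balaban3D.Carriers
open Summit.QuantumFields.Balaban3D.Proofs.Primitives (AlphaConsts)
open Summit.QuantumFields.Balaban3D.Proofs.GroupModelLieC (lieC)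
open Summit.QuantumFields.YangMills.Theorems.BalabanUVNodesN08AlphaEq324RowClassSocketAllSteps (exists_h324Row_freeLetter_of_classSandwich_allSteps_of_forall_gt_ae)
open Literature.Probability.LatticeModels (cumulantOf)

variable {L : ℕ} {G : Type} [GaugeGroup G] [MeasurableSpace G] [HaarData G] (𝔊 : GroupModel G) (𝔠 : AlphaConsts L 𝔊.N) {d : ℕ}

/-- ★★★★ **THE (3.24) ROW AT EVERY RUN STEP FOR EVERY A.E. PRESENTATION BY A CLASS MEMBER — b-ROUTE, END TO END.**  Class scalars `γ_A ≥ 2`, `0 ≤ J_c < γ_A`,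
`θ > 0`, `M, M₂ ≥ 0` (the member currency of `…KernelEq324.eq324_kernel_noPad`), Hamiltonian shape `(D, ϰ > 0)`, threshold parameters `b₀ > 0`, `p₀ > 2∕3`, coupling power
`σ > 0` with `6 + 2κ₀ < σ(n̄ + 1)`, `c₀ ≥ 0`, and THE THRESHOLD WINDOW `hbw : B*_noPad(γ_A, J_c, θ, M, M₂, d, D) < b₀` — seat n08-c's EXPLICIT no-pad threshold
(`…ClassBasicLemmaExplicit.classBasicLemma_kernel_noPad`, written out verbatim) below the record's `b₀`.  THEN `∃ C ≥ 0` (a function of these scalars alone) such that for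
EVERY lattice approximation `S`, tower data `𝔖`, EVERY step `k ≤ K` (no «deep ultraviolet» restriction) and volume factor `v` with `C·v ≤ Ca + Cc`: every per-(h, U) a.e.
presentation of the step block by `gaussianFieldOfKernel (K h U)`, `K h U` the zero-extended covariance of a member `(Λ h U, A h U)`, with cut-off sets `∅ ≠ I h U ⊇ J h U`,
`J h U ⊆ Λ h U`, Hamiltonian letters `a h U` with `sup|coeff| ≤ c₀·g_k^σ` and `|I h U| ≤ v·|T₁^{(k)}|`, gives the row `StepAlphaEq324CoreLTAtAC.h324` ∕ `StepAlphaEq324CoreLTAt.h324`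
at the free letter.  (`classBasicLemma_kernel_noPad` at `(t, D, ϰ) := (n̄, D, ϰ)` ∘ part 3's `exists_h324Row_freeLetter_of_classSandwich_allSteps_of_forall_gt_ae` — two `obtain`s.)
[cite: Balaban1985UV3, (5) p.256 + (41) p.266 + (56)–(58) p.270; Balaban1982Higgs1, (3.24) p.616; BenfattoEtAl1978, Lemma p.152 + b* p.159 (class form; ours);
Balaban1985BackgroundPropagators, Sect. E (class form; ours)] -/
theorem exists_h324Row_freeLetter_of_kernelNoPad_allSteps_ae (hd : 0 < d) {γA Jc θ M M₂ : ℝ} (hγA2 : 2 ≤ γA) (hJc0 : 0 ≤ Jc) (hJcγ : Jc < γA) (hθ : 0 < θ)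
    (hM0 : 0 ≤ M) (hM₂0 : 0 ≤ M₂) (D : ℕ) {ϰ : ℝ} (hϰ : 0 < ϰ) {b₀ p₀ σ c₀ : ℝ} (hb₀ : 0 < b₀) (hp₀ : 2 / 3 < p₀)
    (hσ : 0 < σ) (hc₀ : 0 ≤ c₀) (hκσ : 6 + 2 * 𝔠.κ₀ < σ * (𝔠.nbar + 1))
    (hbw :
      max (max (6 * 2 ^ d * ((d + 1).factorial : ℝ) * (4 / ((min 1 ((γA - Jc) / (4 * (((1 + 2 / θ) * (2 / (1 - Real.exp (-(θ / 2 / Real.sqrt d))) * Real.exp (θ / 2 / Real.sqrt d)) ^ d) * max M γA + max M₂ γA * ((1 + 8 / θ) * (2 / (1 - Real.exp (-(θ / 8 / Real.sqrt d))) * Real.exp (θ / 8 / Real.sqrt d)) ^ d)) + 1))) ^ d) ^ 2) ^ (d + 1)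
      + 10 * (d + 1) * ((⌈1 / (2 * θ) + Real.sqrt (Jc / γA) / θ⌉₊ + 1 : ℕ) : ℝ)
      + 2 / ((min 1 ((γA - Jc) / (4 * (((1 + 2 / θ) * (2 / (1 - Real.exp (-(θ / 2 / Real.sqrt d))) * Real.exp (θ / 2 / Real.sqrt d)) ^ d) * max M γA + max M₂ γA * ((1 + 8 / θ) * (2 / (1 - Real.exp (-(θ / 8 / Real.sqrt d))) * Real.exp (θ / 8 / Real.sqrt d)) ^ d)) + 1))) ^ (d + 1) * Real.sqrt γA)
      + ((min 1 ((γA - Jc) / (4 * (((1 + 2 / θ) * (2 / (1 - Real.exp (-(θ / 2 / Real.sqrt d))) * Real.exp (θ / 2 / Real.sqrt d)) ^ d) * max M γA + max M₂ γA * ((1 + 8 / θ) * (2 / (1 - Real.exp (-(θ / 8 / Real.sqrt d))) * Real.exp (θ / 8 / Real.sqrt d)) ^ d)) + 1))) ^ (d + 1))⁻¹ + 1)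
      (16 * (max M₂ γA * ((1 + 8 / θ) * (2 / (1 - Real.exp (-(θ / 8 / Real.sqrt d))) * Real.exp (θ / 8 / Real.sqrt d)) ^ d)) / (θ * (γA - Jc)) + 1))
      (max (2 / Real.sqrt γA) ((2 * ((D : ℝ) + 2 * d) / γA) ^ 2))
      < b₀) :
    ∃ C : ℝ, 0 ≤ C ∧
      ∀ (S : Scales L) (𝔖 : ∀ k, StepSeries S G ↥(lieC 𝔊) (nblkOf S 𝔠.lane.carrier k) k) (k : ℕ), k ≤ S.K → ∀ (v : ℝ), C * v ≤ 𝔠.Ca + 𝔠.Cc →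
        ∀ (Λ : Hist S.P (k + 1) → GaugeField S.P (k + 1) G → Finset (Fin d → ℤ))
          (A : ∀ h U, Matrix ↥(Λ h U) ↥(Λ h U) ℝ) (K : Hist S.P (k + 1) → GaugeField S.P (k + 1) G → (Fin d → ℤ) → (Fin d → ℤ) → ℝ)
          (Φ : Hist S.P (k + 1) → GaugeField S.P (k + 1) G → ((Fin d → ℤ) → ℝ) → (𝔖 k).Fl)
          (s : ℕ) (I J : Hist S.P (k + 1) → GaugeField S.P (k + 1) G → Finset (Fin d → ℤ))
          (a : Hist S.P (k + 1) → GaugeField S.P (k + 1) G → Coef d),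
          -- the members (`…KernelEq324.eq324_kernel_noPad`'s currency: `hK`, `Λ ≠ ∅`, symmetric, `γ_A`-coercive, rows `J_c, M, M₂`)
          (∀ h U x y, K h U x y = if hxy : x ∈ Λ h U ∧ y ∈ Λ h U then ((A h U)⁻¹ : Matrix ↥(Λ h U) ↥(Λ h U) ℝ) ⟨x, hxy.1⟩ ⟨y, hxy.2⟩ else 0) →
          (∀ h U, (Λ h U).Nonempty) → (∀ h U e e', A h U e e' = A h U e' e) →
          (∀ h U (x : ↥(Λ h U) → ℝ), γA * ∑ e, x e ^ 2 ≤ ∑ e, ∑ e', A h U e e' * x e * x e') →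
          (∀ h U (e : ↥(Λ h U)), ∑ e' : ↥(Λ h U), |A h U e e'| *
              (Real.cosh (θ * Real.sqrt (∑ j, ((((e : Fin d → ℤ) j : ℝ) - ((e' : Fin d → ℤ) j : ℝ))) ^ 2)) - 1) ≤ Jc) →
          (∀ h U (e : ↥(Λ h U)), ∑ e' : ↥(Λ h U), |A h U e e'| * (1 + Real.sqrt (∑ j, ((((e : Fin d → ℤ) j : ℝ) - ((e' : Fin d → ℤ) j : ℝ))) ^ 2)) ≤ M) →
          (∀ h U (e : ↥(Λ h U)), ∑ e' : ↥(Λ h U), |A h U e e'| * Real.exp (θ / 2 * Real.sqrt (∑ j, ((((e : Fin d → ℤ) j : ℝ) - ((e' : Fin d → ℤ) j : ℝ))) ^ 2)) ≤ M₂) →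
          -- the a.e. presentation
          (∀ h U, Measurable (Φ h U)) → (∀ h U, (𝔖 k).μ = (gaussianFieldOfKernel (K h U)).map (Φ h U)) →
          (∀ h, MeasurableSet ((𝔖 k).box h)) → (∀ h U, Measurable ((𝔖 k).𝒱 h U)) →
          (∀ h U, Φ h U ⁻¹' (𝔖 k).box h =ᵐ[gaussianFieldOfKernel (K h U)] smallFieldSet (I h U) (B10.pFun b₀ p₀ (S.gk k))) →
          (∀ h U, (fun z => (𝔖 k).𝒱 h U (Φ h U z)) =ᵐ[gaussianFieldOfKernel (K h U)] hamiltonian s D ϰ (a h U) (J h U)) →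
          -- the instance data
          (∀ h U, (I h U).Nonempty) → (∀ h U, J h U ⊆ I h U) → (∀ h U, J h U ⊆ Λ h U) →
          (∀ h U, coefSup s D (a h U) (J h U) ≤ c₀ * S.gk k ^ σ) → (∀ h U, ((I h U).card : ℝ) ≤ v * S.sites k) →
          ∀ h (U : GaugeField S.P (k + 1) G),
            Eq324 (∫ ω in (𝔖 k).box h, Real.exp ((𝔖 k).𝒱 h U ω) ∂(𝔖 k).μ)
              (fun n => cumulantOf (fun m => ∫ ω, (𝔖 k).𝒱 h U ω ^ m ∂(𝔖 k).μ) n) 𝔠.nbar (𝔠.Ca + 𝔠.Cc)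
              ((L : ℝ) ^ k * S.g0sq) (3 + 𝔠.κ₀) (S.sites k) := by
  obtain ⟨Sc, ρ₁, ρ₂, ρ₃, ρ₄, hS, -, -, hρ₃, -, hall⟩ := classBasicLemma_kernel_noPad (d := d) hd hγA2 hJc0 hJcγ hθ hM0 hM₂0 𝔠.nbar D ϰ hϰ
  obtain ⟨C, hC, h⟩ :=
    exists_h324Row_freeLetter_of_classSandwich_allSteps_of_forall_gt_ae 𝔊 𝔠 (d := d) (D := D) (ϰ := ϰ) (ρ₁ := ρ₁) (ρ₂ := ρ₂) (ρ₄ := ρ₄)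
      hS hρ₃ hb₀ hp₀ hσ hc₀ hκσ hbw
  refine ⟨C, hC, ?_⟩
  intro S 𝔖 k hk v hCv Λ A K Φ s I J a hK hΛ hAs hγA hJc hM hM₂ hΦ hμ hboxm hVm hbox hV hI hJI hJΛ hA hIv
  exact h S 𝔖 k hk v hCv (fun h U => gaussianFieldOfKernel (K h U)) Φ s I J a hΦ hμ hboxm hVm hbox hV hA hIv
    fun h' U b hb => hall (hK h' U) (hΛ h' U) (hAs h' U) (hγA h' U) (hJc h' U) (hM h' U) (hM₂ h' U) s b hb (I h' U) (J h' U) (a h' U)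
      (hI h' U) (hJI h' U) (hJΛ h' U)

/-- **… AT THE RECORD's OWN `b₀ = 𝔠.b₀`, `p₀ = 𝔠.p₀` AND PRINT's COUPLING POWER `σ = 1`** (`5 + 2κ₀ < n̄`): the window reads `B*_noPad(…) < 𝔠.b₀` — a decidable
inequality between the class scalars (N06 [B9] in-edges at [B10]'s data) and the record's `b₀ = √(4·max(N,1)·max(56, 8·A·K_c³∕(½ log L)))`.
[cite: Balaban1985UV3, (7) p.257 + (56)–(58) p.270; Balaban1982Higgs1, (3.24) p.616; BenfattoEtAl1978, Lemma p.152 (class form; ours)] -/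
theorem exists_h324Row_freeLetter_of_kernelNoPad_allSteps_ae_rec_one (hd : 0 < d) {γA Jc θ M M₂ : ℝ} (hγA2 : 2 ≤ γA) (hJc0 : 0 ≤ Jc) (hJcγ : Jc < γA) (hθ : 0 < θ)
    (hM0 : 0 ≤ M) (hM₂0 : 0 ≤ M₂) (D : ℕ) {ϰ : ℝ} (hϰ : 0 < ϰ) {c₀ : ℝ} (hc₀ : 0 ≤ c₀) (hn : 5 + 2 * 𝔠.κ₀ < 𝔠.nbar)
    (hbw :
      max (max (6 * 2 ^ d * ((d + 1).factorial : ℝ) * (4 / ((min 1 ((γA - Jc) / (4 * (((1 + 2 / θ) * (2 / (1 - Real.exp (-(θ / 2 / Real.sqrt d))) * Real.exp (θ / 2 / Real.sqrt d)) ^ d) * max M γA + max M₂ γA * ((1 + 8 / θ) * (2 / (1 - Real.exp (-(θ / 8 / Real.sqrt d))) * Real.exp (θ / 8 / Real.sqrt d)) ^ d)) + 1))) ^ d) ^ 2) ^ (d + 1)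
      + 10 * (d + 1) * ((⌈1 / (2 * θ) + Real.sqrt (Jc / γA) / θ⌉₊ + 1 : ℕ) : ℝ)
      + 2 / ((min 1 ((γA - Jc) / (4 * (((1 + 2 / θ) * (2 / (1 - Real.exp (-(θ / 2 / Real.sqrt d))) * Real.exp (θ / 2 / Real.sqrt d)) ^ d) * max M γA + max M₂ γA * ((1 + 8 / θ) * (2 / (1 - Real.exp (-(θ / 8 / Real.sqrt d))) * Real.exp (θ / 8 / Real.sqrt d)) ^ d)) + 1))) ^ (d + 1) * Real.sqrt γA)
      + ((min 1 ((γA - Jc) / (4 * (((1 + 2 / θ) * (2 / (1 - Real.exp (-(θ / 2 / Real.sqrt d))) * Real.exp (θ / 2 / Real.sqrt d)) ^ d) * max M γA + max M₂ γA * ((1 + 8 / θ) * (2 / (1 - Real.exp (-(θ / 8 / Real.sqrt d))) * Real.exp (θ / 8 / Real.sqrt d)) ^ d)) + 1))) ^ (d + 1))⁻¹ + 1)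
      (16 * (max M₂ γA * ((1 + 8 / θ) * (2 / (1 - Real.exp (-(θ / 8 / Real.sqrt d))) * Real.exp (θ / 8 / Real.sqrt d)) ^ d)) / (θ * (γA - Jc)) + 1))
      (max (2 / Real.sqrt γA) ((2 * ((D : ℝ) + 2 * d) / γA) ^ 2))
      < 𝔠.b₀) :
    ∃ C : ℝ, 0 ≤ C ∧
      ∀ (S : Scales L) (𝔖 : ∀ k, StepSeries S G ↥(lieC 𝔊) (nblkOf S 𝔠.lane.carrier k) k) (k : ℕ), k ≤ S.K → ∀ (v : ℝ), C * v ≤ 𝔠.Ca + 𝔠.Cc →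
        ∀ (Λ : Hist S.P (k + 1) → GaugeField S.P (k + 1) G → Finset (Fin d → ℤ))
          (A : ∀ h U, Matrix ↥(Λ h U) ↥(Λ h U) ℝ) (K : Hist S.P (k + 1) → GaugeField S.P (k + 1) G → (Fin d → ℤ) → (Fin d → ℤ) → ℝ)
          (Φ : Hist S.P (k + 1) → GaugeField S.P (k + 1) G → ((Fin d → ℤ) → ℝ) → (𝔖 k).Fl)
          (s : ℕ) (I J : Hist S.P (k + 1) → GaugeField S.P (k + 1) G → Finset (Fin d → ℤ))
          (a : Hist S.P (k + 1) → GaugeField S.P (k + 1) G → Coef d),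
          -- the members (`…KernelEq324.eq324_kernel_noPad`'s currency: `hK`, `Λ ≠ ∅`, symmetric, `γ_A`-coercive, rows `J_c, M, M₂`)
          (∀ h U x y, K h U x y = if hxy : x ∈ Λ h U ∧ y ∈ Λ h U then ((A h U)⁻¹ : Matrix ↥(Λ h U) ↥(Λ h U) ℝ) ⟨x, hxy.1⟩ ⟨y, hxy.2⟩ else 0) →
          (∀ h U, (Λ h U).Nonempty) → (∀ h U e e', A h U e e' = A h U e' e) →
          (∀ h U (x : ↥(Λ h U) → ℝ), γA * ∑ e, x e ^ 2 ≤ ∑ e, ∑ e', A h U e e' * x e * x e') →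
          (∀ h U (e : ↥(Λ h U)), ∑ e' : ↥(Λ h U), |A h U e e'| *
              (Real.cosh (θ * Real.sqrt (∑ j, ((((e : Fin d → ℤ) j : ℝ) - ((e' : Fin d → ℤ) j : ℝ))) ^ 2)) - 1) ≤ Jc) →
          (∀ h U (e : ↥(Λ h U)), ∑ e' : ↥(Λ h U), |A h U e e'| * (1 + Real.sqrt (∑ j, ((((e : Fin d → ℤ) j : ℝ) - ((e' : Fin d → ℤ) j : ℝ))) ^ 2)) ≤ M) →
          (∀ h U (e : ↥(Λ h U)), ∑ e' : ↥(Λ h U), |A h U e e'| * Real.exp (θ / 2 * Real.sqrt (∑ j, ((((e : Fin d → ℤ) j : ℝ) - ((e' : Fin d → ℤ) j : ℝ))) ^ 2)) ≤ M₂) →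
          -- the a.e. presentation
          (∀ h U, Measurable (Φ h U)) → (∀ h U, (𝔖 k).μ = (gaussianFieldOfKernel (K h U)).map (Φ h U)) →
          (∀ h, MeasurableSet ((𝔖 k).box h)) → (∀ h U, Measurable ((𝔖 k).𝒱 h U)) →
          (∀ h U, Φ h U ⁻¹' (𝔖 k).box h =ᵐ[gaussianFieldOfKernel (K h U)] smallFieldSet (I h U) (B10.pFun 𝔠.b₀ 𝔠.p₀ (S.gk k))) →
          (∀ h U, (fun z => (𝔖 k).𝒱 h U (Φ h U z)) =ᵐ[gaussianFieldOfKernel (K h U)] hamiltonian s D ϰ (a h U) (J h U)) →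
          -- the instance data
          (∀ h U, (I h U).Nonempty) → (∀ h U, J h U ⊆ I h U) → (∀ h U, J h U ⊆ Λ h U) →
          (∀ h U, coefSup s D (a h U) (J h U) ≤ c₀ * S.gk k) → (∀ h U, ((I h U).card : ℝ) ≤ v * S.sites k) →
          ∀ h (U : GaugeField S.P (k + 1) G),
            Eq324 (∫ ω in (𝔖 k).box h, Real.exp ((𝔖 k).𝒱 h U ω) ∂(𝔖 k).μ)
              (fun n => cumulantOf (fun m => ∫ ω, (𝔖 k).𝒱 h U ω ^ m ∂(𝔖 k).μ) n) 𝔠.nbar (𝔠.Ca + 𝔠.Cc)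
              ((L : ℝ) ^ k * S.g0sq) (3 + 𝔠.κ₀) (S.sites k) := by
  obtain ⟨C, hC, h⟩ :=
    exists_h324Row_freeLetter_of_kernelNoPad_allSteps_ae 𝔊 𝔠 (d := d) hd hγA2 hJc0 hJcγ hθ hM0 hM₂0 D hϰ (b₀ := 𝔠.b₀) (p₀ := 𝔠.p₀) (σ := 1)
      𝔠.b₀_pos (by linarith [𝔠.two_lt_p₀]) one_pos hc₀ (by linarith) hbw
  refine ⟨C, hC, ?_⟩
  intro S 𝔖 k hk v hCv Λ A K Φ s I J a hK hΛ hAs hγA hJc hM hM₂ hΦ hμ hboxm hVm hbox hV hI hJI hJΛ hA hIv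
  exact h S 𝔖 k hk v hCv Λ A K Φ s I J a hK hΛ hAs hγA hJc hM hM₂ hΦ hμ hboxm hVm hbox hV hI hJI hJΛ
    (fun h' U => by rw [Real.rpow_one]; exact hA h' U) hIv

end Summit.QuantumFields.YangMills.Theorems.BalabanUVNodesN08AlphaEq324RowClassSocketEndAllSteps

end
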